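import Literature.Computability.Complexity.FKPointLocationEncoding
import HarnessLib

/-!
# Fournier–Koiran point location, X: polynomial size of the states of the protocol

Topic `Literature/Computability/Complexity`, grouping namespace `FKPointLocation`. A syntactic size
invariant of the untyped states along ANY run of the untyped transition `uupd` on tasks with bounded
arguments (`USz P K t d`: list lengths at most the step count `t` or the dimension, all integers below
`2^K`, the magnitude exponent `K` growing by `3` per step), its preservation (`usz_uupd`), and the
resulting explicit polynomial bound on the length of the state code (`length_dataE_le`). This is the
"all the data have polynomial size" clause of the report (§2.2), in the form the clocked state machine
needs (the cap on its transition is inactive along genuine runs).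

## References

* H. Fournier, P. Koiran, *Lower bounds are not easier over the reals: inside PH*, ICALP 2000,
  LNCS 1853 = LIP RR-1999-21, §2.2. [FournierKoiran2000]
-/

namespace Literature.Computability.Complexity

namespace FKPointLocation

open _root_.Computability CodeFP

/-! ### Bounded vectors and records -/

/-- A bounded integer vector: at most `D` entries, all below `2^K` in absolute value. [folklore] -/
def VecBnd (D K : ℕ) (l : List ℤ) : Prop := l.length ≤ D ∧ ∀ a ∈ l, a.natAbs < 2 ^ K

namespace VecBnd

variable {D K K' : ℕ} {l : List ℤ}

/-- Bound bookkeeping (`mono`). [folklore] -/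
theorem mono (h : VecBnd D K l) (hK : K ≤ K') : VecBnd D K' l :=
  ⟨h.1, fun a ha => lt_of_lt_of_le (h.2 a ha) (Nat.pow_le_pow_right (by norm_num) hK)⟩

/-- Bound bookkeeping (`replicate_zero`). [folklore] -/
theorem replicate_zero (D K : ℕ) : VecBnd D K (List.replicate D 0) :=
  ⟨by simp, fun a ha => by rw [List.eq_of_mem_replicate ha]; simp⟩

/-- Bound bookkeeping (`set`). [folklore] -/
theorem set (h : VecBnd D K l) (i : ℕ) {v : ℤ} (hv : v.natAbs < 2 ^ K) : VecBnd D K (l.set i v) :=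
  ⟨by rw [List.length_set]; exact h.1, fun a ha => by
    rcases List.mem_or_eq_of_mem_set ha with ha | rfl
    · exact h.2 a ha
    · exact hv⟩

/-- Bound bookkeeping (`nil`). [folklore] -/
theorem nil (D K : ℕ) : VecBnd D K [] := ⟨Nat.zero_le _, fun _ h => by simp at h⟩

end VecBnd

/-- Any chunk decodes below `2^{|c|}`. [folklore] -/
theorem natAbs_chunkInt_lt_length (c : List Bool) : (chunkInt c).natAbs < 2 ^ c.length := by
  by_cases hc : c = []
  · subst hc; simp [chunkInt]
  · exact lt_of_lt_of_le (natAbs_chunkInt_lt c hc) (Nat.pow_le_pow_right (by norm_num) (Nat.sub_le _ _))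

/-- Decoded forms are bounded. [folklore] -/
theorem vecBnd_udecodeForm (b D K : ℕ) (hK : b + 1 ≤ K) (w : List Bool) : VecBnd D K (udecodeForm b D w) := by
  refine ⟨by simp [udecodeForm], fun a ha => ?_⟩
  simp only [udecodeForm, List.mem_map, List.mem_range] at ha
  obtain ⟨i, _, rfl⟩ := ha
  refine lt_of_lt_of_le (natAbs_chunkInt_lt_length _) (Nat.pow_le_pow_right (by norm_num) ?_)
  exact (List.length_take_le _ _).trans hK

/-- The bound on task arguments along the schedule. [folklore] -/
def UParams.amax (P : UParams) : ℕ := P.D + P.L + P.Wf + P.Wa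

/-- The initial magnitude exponent. [folklore] -/
def UParams.K₀ (P : UParams) : ℕ := P.L + P.W + P.bB + 4

/-- A bounded level record. [folklore] -/
structure RecBnd (P : UParams) (K : ℕ) (r : ULevelRec) : Prop where
  m : VecBnd P.D K r.m
  sc : r.sc ≤ P.amax
  apexN : VecBnd P.D K r.apexN
  apexD : r.apexD < 2 ^ K
  istar : r.istar ≤ P.amax
  εstar : r.εstar.natAbs ≤ 1

/-- Bound bookkeeping (`mono`). [folklore] -/
theorem RecBnd.mono {P : UParams} {K K' : ℕ} {r : ULevelRec} (h : RecBnd P K r) (hK : K ≤ K') : RecBnd P K' r :=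
  ⟨h.m.mono hK, h.sc, h.apexN.mono hK, lt_of_lt_of_le h.apexD (Nat.pow_le_pow_right (by norm_num) hK), h.istar, h.εstar⟩

/-- A bounded scratch after `t` steps. [folklore] -/
structure ScrBnd (P : UParams) (K t : ℕ) (c : UScratch) : Prop where
  m : VecBnd P.D K c.m
  bsAcc : c.bsAcc < 2 ^ K
  chainLen : c.chain.length ≤ t
  chain : ∀ f ∈ c.chain, VecBnd P.D K f
  exBits : c.bits.length ≤ t
  stSc : ∀ sc ∈ c.stable.map Prod.fst, sc ≤ P.amax
  stChainLen : ((c.stable.map Prod.snd).getD []).length ≤ t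
  stChain : ∀ f ∈ (c.stable.map Prod.snd).getD [], VecBnd P.D K f
  apexN : VecBnd P.D K c.apexN
  apexD : c.apexD < 2 ^ K
  ge : c.ge.length ≤ P.D
  le : c.le.length ≤ P.D
  cand : ∀ i ∈ c.cand, i ≤ P.amax

/-- Bound bookkeeping (`mono`). [folklore] -/
theorem ScrBnd.mono {P : UParams} {K K' t t' : ℕ} {c : UScratch} (h : ScrBnd P K t c) (hK : K ≤ K') (ht : t ≤ t') :
    ScrBnd P K' t' c :=
  ⟨h.m.mono hK, lt_of_lt_of_le h.bsAcc (Nat.pow_le_pow_right (by norm_num) hK), h.chainLen.trans ht,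
    fun f hf => (h.chain f hf).mono hK, h.exBits.trans ht, h.stSc, h.stChainLen.trans ht,
    fun f hf => (h.stChain f hf).mono hK, h.apexN.mono hK,
    lt_of_lt_of_le h.apexD (Nat.pow_le_pow_right (by norm_num) hK), h.ge, h.le, h.cand⟩

/-- The fresh scratch is bounded. [folklore] -/
theorem scrBnd_init (P : UParams) (K t : ℕ) (hK : 1 ≤ K) : ScrBnd P K t (UScratch.init P.D) where
  m := VecBnd.replicate_zero _ _
  bsAcc := by show (0 : ℕ) < 2 ^ K; positivity
  chainLen := by simp [UScratch.init]
  chain := by simp [UScratch.init]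
  exBits := by simp [UScratch.init]
  stSc := by simp [UScratch.init]
  stChainLen := by simp [UScratch.init]
  stChain := by simp [UScratch.init]
  apexN := VecBnd.replicate_zero _ _
  apexD := by show (1 : ℕ) < 2 ^ K; exact Nat.one_lt_two_pow (by omega)
  ge := by simp [UScratch.init]
  le := by simp [UScratch.init]
  cand := by simp [UScratch.init]

namespace ScrBnd

variable {P : UParams} {K t : ℕ} {c : UScratch}

/-- Updating the centre numerators and the accumulator. [folklore] -/
theorem with_m_bsAcc (h : ScrBnd P K t c) {m' : List ℤ} {acc' : ℕ} (hm : VecBnd P.D K m') (hacc : acc' < 2 ^ K) :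
    ScrBnd P K t { c with m := m', bsAcc := acc' } :=
  ⟨hm, hacc, h.chainLen, h.chain, h.exBits, h.stSc, h.stChainLen, h.stChain, h.apexN, h.apexD, h.ge, h.le, h.cand⟩

/-- Updating the accumulator. [folklore] -/
theorem with_bsAcc (h : ScrBnd P K t c) {acc' : ℕ} (hacc : acc' < 2 ^ K) : ScrBnd P K t { c with bsAcc := acc' } :=
  ⟨h.m, hacc, h.chainLen, h.chain, h.exBits, h.stSc, h.stChainLen, h.stChain, h.apexN, h.apexD, h.ge, h.le, h.cand⟩

/-- Resetting the prefix bits and the existence flag. [folklore] -/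
theorem with_exOk_bits (h : ScrBnd P K t c) (e : Bool) {bits' : List Bool} (hb : bits'.length ≤ t) :
    ScrBnd P K t { c with exOk := e, bits := bits' } :=
  ⟨h.m, h.bsAcc, h.chainLen, h.chain, hb, h.stSc, h.stChainLen, h.stChain, h.apexN, h.apexD, h.ge, h.le, h.cand⟩

/-- Updating the prefix bits. [folklore] -/
theorem with_bits (h : ScrBnd P K t c) {bits' : List Bool} (hb : bits'.length ≤ t) : ScrBnd P K t { c with bits := bits' } :=
  ⟨h.m, h.bsAcc, h.chainLen, h.chain, hb, h.stSc, h.stChainLen, h.stChain, h.apexN, h.apexD, h.ge, h.le, h.cand⟩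

/-- Extending the chain. [folklore] -/
theorem with_chain (h : ScrBnd P K t c) {ch : List (List ℤ)} (hlen : ch.length ≤ t) (hch : ∀ f ∈ ch, VecBnd P.D K f)
    {bits' : List Bool} (hb : bits'.length ≤ t) (e : Bool) :
    ScrBnd P K t { c with chain := ch, bits := bits', exOk := e } :=
  ⟨h.m, h.bsAcc, hlen, hch, hb, h.stSc, h.stChainLen, h.stChain, h.apexN, h.apexD, h.ge, h.le, h.cand⟩

/-- Setting the stable pair and resetting the chain. [folklore] -/
theorem with_stable (h : ScrBnd P K t c) {st : Option (ℕ × List (List ℤ))} (hsc : ∀ sc ∈ st.map Prod.fst, sc ≤ P.amax)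
    (hlen : ((st.map Prod.snd).getD []).length ≤ t) (hch : ∀ f ∈ (st.map Prod.snd).getD [], VecBnd P.D K f) :
    ScrBnd P K t { c with stable := st, chain := [], bits := [], exOk := false } :=
  ⟨h.m, h.bsAcc, by simp, by simp, by simp, hsc, hlen, hch, h.apexN, h.apexD, h.ge, h.le, h.cand⟩

/-- Setting the apex. [folklore] -/
theorem with_apex (h : ScrBnd P K t c) {N : List ℤ} {d : ℕ} (hN : VecBnd P.D K N) (hd : d < 2 ^ K) :
    ScrBnd P K t { c with apexN := N, apexD := d, bits := [] } :=
  ⟨h.m, h.bsAcc, h.chainLen, h.chain, by simp, h.stSc, h.stChainLen, h.stChain, hN, hd, h.ge, h.le, h.cand⟩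

/-- Updating the answer lists. [folklore] -/
theorem with_ge (h : ScrBnd P K t c) {g : List Bool} (hg : g.length ≤ P.D) : ScrBnd P K t { c with ge := g } :=
  ⟨h.m, h.bsAcc, h.chainLen, h.chain, h.exBits, h.stSc, h.stChainLen, h.stChain, h.apexN, h.apexD, hg, h.le, h.cand⟩

/-- Bound bookkeeping (`with_le`). [folklore] -/
theorem with_le (h : ScrBnd P K t c) {g : List Bool} (hg : g.length ≤ P.D) : ScrBnd P K t { c with le := g } :=
  ⟨h.m, h.bsAcc, h.chainLen, h.chain, h.exBits, h.stSc, h.stChainLen, h.stChain, h.apexN, h.apexD, h.ge, hg, h.cand⟩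

/-- Updating the candidate. [folklore] -/
theorem with_cand (h : ScrBnd P K t c) {o : Option ℕ} (ho : ∀ i ∈ o, i ≤ P.amax) : ScrBnd P K t { c with cand := o } :=
  ⟨h.m, h.bsAcc, h.chainLen, h.chain, h.exBits, h.stSc, h.stChainLen, h.stChain, h.apexN, h.apexD, h.ge, h.le, ho⟩

end ScrBnd

/-- **The size invariant** of a state after `t` steps, with magnitude exponent `K`. [cite: FournierKoiran2000, §2.2] -/
structure USz (P : UParams) (K t : ℕ) (d : UData) : Prop where
  chartLen : d.chart.length ≤ P.D
  chart : ∀ a ∈ d.chart, a.natAbs ≤ 1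
  levelsLen : d.levels.length ≤ t
  levels : ∀ r ∈ d.levels, RecBnd P K r
  cur : ScrBnd P K t d.cur

/-- Bound bookkeeping (`mono`). [folklore] -/
theorem USz.mono {P : UParams} {K K' t t' : ℕ} {d : UData} (h : USz P K t d) (hK : K ≤ K') (ht : t ≤ t') :
    USz P K' t' d :=
  ⟨h.chartLen, h.chart, h.levelsLen.trans ht, fun r hr => (h.levels r hr).mono hK, h.cur.mono hK ht⟩

/-- The initial state is bounded. [folklore] -/
theorem usz_init (P : UParams) (K t : ℕ) (hK : 1 ≤ K) : USz P K t (UData.init P.D) where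
  chartLen := by simp [UData.init]
  chart := by intro a ha; simp [UData.init] at ha; rw [ha.2]; simp
  levelsLen := by simp [UData.init]
  levels := by simp [UData.init]
  cur := scrBnd_init P K t hK

/-- Task arguments bounded by `amax`. [folklore] -/
def UTask.ArgsLe (τ : UTask) (A : ℕ) : Prop := ∀ a ∈ τ.args, a ≤ A

namespace USz

variable {P : UParams} {K t : ℕ} {d : UData}

/-- Replacing the scratch. [folklore] -/
theorem with_cur (h : USz P K t d) {c : UScratch} (hc : ScrBnd P K t c) : USz P K t { d with cur := c } :=
  ⟨h.chartLen, h.chart, h.levelsLen, h.levels, hc⟩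

/-- Setting the output bit. [folklore] -/
theorem with_out (h : USz P K t d) (b : Bool) : USz P K t { d with out := b } :=
  ⟨h.chartLen, h.chart, h.levelsLen, h.levels, h.cur⟩

end USz

/-! ### Preservation -/

section Preservation

variable {P : UParams} {K t : ℕ} {d : UData}

/-- Reading a chart entry. [folklore] -/
theorem natAbs_vget_le {l : List ℤ} {M : ℕ} (h : ∀ a ∈ l, a.natAbs ≤ M) (i : ℕ) : (vget l i).natAbs ≤ M := by
  unfold vget
  rw [List.getD_eq_getElem?_getD]
  rcases hgi : l[i]? with _ | a
  · simp
  · simpa using h a (List.mem_of_getElem? hgi)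

/-- `finishLevel` preserves the invariant (one more level). [cite: FournierKoiran2000, §2.2] -/
theorem usz_ufinishLevel (h : USz P K t d) (hK : 1 ≤ K) : USz P K (t + 1) (ufinishLevel P d) := by
  have hrec : ∀ (ist : ℕ) (ε : ℤ), ist ≤ P.amax → ε.natAbs ≤ 1 → RecBnd P K (ucloseRec d.cur ist ε) := by
    intro ist ε hist hε
    refine ⟨h.cur.m, ?_, h.cur.apexN, h.cur.apexD, hist, hε⟩
    show ((d.cur.stable.map Prod.fst).getD 0) ≤ P.amax
    rcases hs : d.cur.stable with _ | ⟨sc, ch⟩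
    · simp
    · have := h.cur.stSc sc (by simp [hs]); simpa
  have hlen : (d.levels.length + 1) ≤ t + 1 := Nat.succ_le_succ h.levelsLen
  unfold ufinishLevel
  rcases hc : d.cur.cand with _ | c
  · exact { chartLen := h.chartLen, chart := h.chart, levelsLen := by simpa using hlen,
            levels := fun r hr => by
              rcases List.mem_cons.1 hr with rfl | hr
              · exact hrec 0 1 (Nat.zero_le _) (by simp)
              · exact h.levels r hr,
            cur := scrBnd_init P K (t + 1) hK }
  · have hcle : c ≤ P.amax := h.cur.cand c (by simp [hc])
    exact { chartLen := by rw [List.length_set]; exact h.chartLen,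
            chart := fun a ha => by
              rcases List.mem_or_eq_of_mem_set ha with ha | rfl
              · exact h.chart a ha
              · split_ifs <;> simp,
            levelsLen := by simpa using hlen,
            levels := fun r hr => by
              rcases List.mem_cons.1 hr with rfl | hr
              · exact hrec c _ hcle (by split_ifs <;> simp)
              · exact h.levels r hr,
            cur := scrBnd_init P K (t + 1) hK }

/-- **Preservation of the size invariant by one step** (magnitudes may grow by three bits).
[cite: FournierKoiran2000, §2.2] -/
theorem usz_uupd (h : USz P K t d) (hK : P.K₀ ≤ K) (τ : UTask) (hτ : τ.ArgsLe P.amax) (b : Bool) :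
    USz P (K + 3) (t + 1) (uupd P d τ b) := by
  have hK1 : 1 ≤ K := by unfold UParams.K₀ at hK; omega
  have h' : USz P (K + 3) (t + 1) d := h.mono (by omega) (by omega)
  have hpow3 : (2 : ℕ) ^ (K + 3) = 8 * 2 ^ K := by rw [pow_add]; ring
  have hL : 2 ^ (P.L + 1) ≤ 2 ^ K := Nat.pow_le_pow_right (by norm_num) (by unfold UParams.K₀ at hK; omega)
  have h4 : 4 ≤ 2 ^ K := by
    calc (4 : ℕ) = 2 ^ 2 := by norm_num
      _ ≤ 2 ^ K := Nat.pow_le_pow_right (by norm_num) (by unfold UParams.K₀ at hK; omega)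
  have hbits : (d.cur.bits ++ [b]).length ≤ t + 1 := by
    rw [List.length_append, List.length_singleton]; exact Nat.add_le_add_right h.cur.exBits 1
  unfold uupd
  by_cases hd : d.done
  · rw [if_pos hd]; exact h'
  rw [if_neg hd]
  cases τ with
  | bs i k =>
    simp only
    have hacc : (if k = 0 then 0 else d.cur.bsAcc) < 2 ^ K := by
      split_ifs
      · positivity
      · exact h.cur.bsAcc
    have hb : b.toNat ≤ 1 := Bool.toNat_le b
    have hv : ∀ acc : ℕ, acc < 2 ^ K →
        (2 * ((2 * acc + b.toNat : ℕ) : ℤ) + 1 - 2 ^ (P.L + 1)).natAbs < 2 ^ (K + 3) := by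
      intro acc hacc
      have h1 : (2 * ((2 * acc + b.toNat : ℕ) : ℤ) + 1 - 2 ^ (P.L + 1)).natAbs ≤
          (2 * (2 * acc + b.toNat) + 1) + 2 ^ (P.L + 1) := by
        refine (Int.natAbs_sub_le _ _).trans ?_
        have e1 : (2 * ((2 * acc + b.toNat : ℕ) : ℤ) + 1).natAbs = 2 * (2 * acc + b.toNat) + 1 := by
          rw [show (2 * ((2 * acc + b.toNat : ℕ) : ℤ) + 1) = ((2 * (2 * acc + b.toNat) + 1 : ℕ) : ℤ) by push_cast; ring,
            Int.natAbs_natCast]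
        have e2 : ((2 : ℤ) ^ (P.L + 1)).natAbs = 2 ^ (P.L + 1) := by rw [Int.natAbs_pow]; rfl
        rw [e1, e2]
      rw [hpow3]
      omega
    have hacc2 : ∀ acc : ℕ, acc < 2 ^ K → 2 * acc + b.toNat < 2 ^ (K + 3) := fun acc hacc => by rw [hpow3]; omega
    by_cases hc : vget d.chart i ≠ 0
    · rw [if_pos hc]
      split_ifs with hk
      · -- fixed coordinate, last round
        refine h'.with_cur (h'.cur.with_m_bsAcc (h'.cur.m.set i ?_) (by positivity))
        have hci : (vget d.chart i).natAbs ≤ 1 := natAbs_vget_le h.chart i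
        rw [Int.natAbs_mul, Int.natAbs_pow, hpow3]
        calc (vget d.chart i).natAbs * (2 : ℤ).natAbs ^ (P.L + 1) ≤ 1 * 2 ^ (P.L + 1) := Nat.mul_le_mul hci le_rfl
          _ < 8 * 2 ^ K := by omega
      · exact h'
    · rw [if_neg hc]
      have h0 : (0 : ℕ) < 2 ^ K := by positivity
      have h0' : (0 : ℕ) < 2 ^ (K + 3) := by positivity
      have hA := h.cur.bsAcc
      split_ifs <;> first
        | exact h'.with_cur (h'.cur.with_m_bsAcc (h'.cur.m.set i (hv _ h0)) h0')
        | exact h'.with_cur (h'.cur.with_m_bsAcc (h'.cur.m.set i (hv _ hA)) h0')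
        | exact h'.with_cur (h'.cur.with_bsAcc (hacc2 _ h0))
        | exact h'.with_cur (h'.cur.with_bsAcc (hacc2 _ hA))
  | ex sc m => exact h'.with_cur (h'.cur.with_exOk_bits b (by simp))
  | pf sc m w =>
    simp only
    split_ifs with he hw
    · refine h'.with_cur (h'.cur.with_chain ?_ ?_ (by simp) false)
      · rw [List.length_append, List.length_singleton]; exact Nat.add_le_add_right h.cur.chainLen 1
      · intro f hf
        rcases List.mem_append.1 hf with hf | hf
        · exact (h.cur.chain f hf).mono (by omega)
        · rw [List.mem_singleton.1 hf]
          exact vecBnd_udecodeForm _ _ _ (by unfold UParams.K₀ at hK; omega) _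
    · exact h'.with_cur (h'.cur.with_bits hbits)
    · exact h'
  | st sc =>
    have hsc : sc ≤ P.amax := hτ sc (by simp [UTask.args])
    rcases hs : d.cur.stable with _ | p
    · cases b
      · simp only [stableUpd_none, Bool.false_eq_true, if_false]
        exact h'.with_cur (h'.cur.with_stable (by simp [hsc]) (h.cur.chainLen.trans (Nat.le_succ t))
          (fun f hf => (h.cur.chain f hf).mono (by omega)))
      · simp only [stableUpd_none, if_true]
        exact h'.with_cur (h'.cur.with_stable (by simp) (by simp) (by simp))
    · simp only [stableUpd_some]
      refine h'.with_cur (h'.cur.with_stable ?_ ?_ ?_)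
      · have := h.cur.stSc; rw [hs] at this; exact this
      · have := h'.cur.stChainLen; rw [hs] at this; exact this
      · have := h'.cur.stChain; rw [hs] at this; exact this
  | ap w =>
    simp only
    split_ifs with hw
    · refine h'.with_cur (h'.cur.with_apex ?_ ?_)
      · exact vecBnd_udecodeForm _ _ _ (by unfold UParams.K₀ at hK; omega) _
      · show bitsToNat ((d.cur.bits ++ [b]).take P.W) < 2 ^ (K + 3)
        refine lt_of_lt_of_le (bitsToNat_lt _) (Nat.pow_le_pow_right (by norm_num) ?_)
        exact (List.length_take_le _ _).trans (by unfold UParams.K₀ at hK; omega)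
    · exact h'.with_cur (h'.cur.with_bits hbits)
  | eqGe i => exact h'.with_cur (h'.cur.with_ge (by rw [List.length_set]; exact h.cur.ge))
  | eqLe i => exact h'.with_cur (h'.cur.with_le (by rw [List.length_set]; exact h.cur.le))
  | fa i =>
    have hi : i ≤ P.amax := hτ i (by simp [UTask.args])
    refine h'.with_cur (h'.cur.with_cand ?_)
    rcases hc : d.cur.cand with _ | c
    · intro j hj
      simp only [candUpd_none] at hj
      split_ifs at hj with hv
      · simp only [Option.mem_def, Option.some.injEq] at hj; subst hj; exact hi
      · simp at hj
    · have hcle : c ≤ P.amax := h.cur.cand c (by simp [hc])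
      intro j hj
      simp only [candUpd_some] at hj
      split_ifs at hj with hv
      · simp only [Option.mem_def, Option.some.injEq] at hj; subst hj; exact hi
      · simp only [Option.mem_def, Option.some.injEq] at hj; subst hj; exact hcle
  | close => exact (usz_ufinishLevel h hK1).mono (by omega) le_rfl
  | fin => exact h'.with_out b

/-- **The invariant along a run**: after `t` steps on tasks with bounded arguments from a state
satisfying `USz P K₀' 0`, the state satisfies `USz P (K₀' + 3t) t`. [cite: FournierKoiran2000, §2.2] -/
theorem usz_foldl (P : UParams) {K : ℕ} (hK : P.K₀ ≤ K) :
    ∀ (steps : List (UTask × Bool)) (t : ℕ) (d : UData), USz P (K + 3 * t) t d → (∀ s ∈ steps, s.1.ArgsLe P.amax) →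
      USz P (K + 3 * (t + steps.length)) (t + steps.length) (steps.foldl (fun d s => uupd P d s.1 s.2) d)
  | [], t, d, h, _ => by simpa using h
  | s :: steps, t, d, h, hs => by
    rw [List.foldl_cons]
    have h1 := usz_uupd h (hK.trans (Nat.le_add_right _ _)) s.1 (hs s (by simp)) s.2
    have h1' : USz P (K + 3 * (t + 1)) (t + 1) (uupd P d s.1 s.2) := by
      have : K + 3 * t + 3 = K + 3 * (t + 1) := by ring
      rw [← this]; exact h1
    have := usz_foldl P hK steps (t + 1) _ h1' (fun s' hs' => hs s' (by simp [hs']))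
    simp only [List.length_cons]
    have e : t + 1 + steps.length = t + (steps.length + 1) := by ring
    rw [e] at this
    exact this

end Preservation

/-! ### The length of the state code -/

section Length

variable {P : UParams} {K t : ℕ}

/-- Length of a bounded vector code. [folklore] -/
theorem length_vecE_of_vecBnd {D : ℕ} {l : List ℤ} (h : VecBnd D K l) : (vecE l).length ≤ D * (6 * K + 6) :=
  (length_vecE_le h.2).trans (Nat.mul_le_mul_right _ h.1)

/-- Length of a level record code. [folklore] -/
theorem length_lrecE_le {r : ULevelRec} (h : RecBnd P K r) :
    (lrecE r).length ≤ 4 * (P.D * (6 * K + 6)) + 4 * Nat.size P.amax + 2 * K + 34 := by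
  have h1 := length_vecE_of_vecBnd h.m
  have h2 : (natE r.sc).length ≤ Nat.size P.amax := by rw [length_natE]; exact size_mono h.sc
  have h3 := length_vecE_of_vecBnd h.apexN
  have h4 : (natE r.apexD).length ≤ K := by rw [length_natE]; exact size_le_of_lt_two_pow h.apexD
  have h5 : (natE r.istar).length ≤ Nat.size P.amax := by rw [length_natE]; exact size_mono h.istar
  have h6 : (intE r.εstar).length ≤ 5 := (length_intE_le _).trans (by
    have : Nat.size r.εstar.natAbs ≤ 1 := size_le_of_lt_two_pow (by have := h.εstar; omega)
    omega)
  simp only [lrecE, lrecFields, rawE_cons, rawE_nil, length_boolPair, List.length_nil]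
  change 2 * (vecE r.m).length + 2 + (2 * (natE r.sc).length + 2 + (2 * (vecE r.apexN).length + 2 +
    (2 * (natE r.apexD).length + 2 + (2 * (natE r.istar).length + 2 + (2 * (intE r.εstar).length + 2 + 0))))) ≤ _
  omega

/-- Length of a raw list of bounded vectors. [folklore] -/
theorem length_rawE_vecE_le {L : List (List ℤ)} (hlen : L.length ≤ t) (h : ∀ f ∈ L, VecBnd P.D K f) :
    (rawE vecE L).length ≤ t * (2 * (P.D * (6 * K + 6)) + 2) :=
  (length_rawE_le_of_forall vecE (fun f hf => length_vecE_of_vecBnd (h f hf))).trans (Nat.mul_le_mul_right _ hlen)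

/-- The scratch size polynomial. [folklore] -/
def scrSize (P : UParams) (K t : ℕ) : ℕ :=
  4 * (P.D * (6 * K + 6)) + 4 * K + 4 * (t * (2 * (P.D * (6 * K + 6)) + 2)) + 2 * t +
    8 * Nat.size P.amax + 16 * P.D + 34

/-- Length of a scratch code. [folklore] -/
theorem length_scrE_le {c : UScratch} (h : ScrBnd P K t c) : (scrE c).length ≤ scrSize P K t := by
  have h1 := length_vecE_of_vecBnd h.m
  have h2 : (natE c.bsAcc).length ≤ K := by rw [length_natE]; exact size_le_of_lt_two_pow h.bsAcc
  have h3 := length_rawE_vecE_le h.chainLen h.chain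
  have h4 : (bitE c.exOk).length = 1 := rfl
  have h5 : c.bits.length ≤ t := h.exBits
  have h6 : (optE natE (c.stable.map Prod.fst)).length ≤ 2 * Nat.size P.amax + 2 :=
    length_optE_natE_le (k := Nat.size P.amax) fun a ha => lt_of_le_of_lt (h.stSc a ha) (Nat.lt_size_self _)
  have h7 := length_rawE_vecE_le h.stChainLen h.stChain
  have h8 := length_vecE_of_vecBnd h.apexN
  have h9 : (natE c.apexD).length ≤ K := by rw [length_natE]; exact size_le_of_lt_two_pow h.apexD
  have h10 : (rawE bitE c.ge).length ≤ 4 * P.D := by rw [length_rawE_bitE]; exact Nat.mul_le_mul_left 4 h.ge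
  have h11 : (rawE bitE c.le).length ≤ 4 * P.D := by rw [length_rawE_bitE]; exact Nat.mul_le_mul_left 4 h.le
  have h12 : (optE natE c.cand).length ≤ 2 * Nat.size P.amax + 2 :=
    length_optE_natE_le (k := Nat.size P.amax) fun a ha => lt_of_le_of_lt (h.cand a ha) (Nat.lt_size_self _)
  simp only [scrE, scrFields, rawE_cons, rawE_nil, length_boolPair, List.length_nil]
  unfold scrSize
  change 2 * (vecE c.m).length + 2 + (2 * (natE c.bsAcc).length + 2 + (2 * (rawE vecE c.chain).length + 2 +
    (2 * (bitE c.exOk).length + 2 + (2 * c.bits.length + 2 + (2 * (optE natE (c.stable.map Prod.fst)).length + 2 +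
    (2 * (rawE vecE ((c.stable.map Prod.snd).getD [])).length + 2 + (2 * (vecE c.apexN).length + 2 +
    (2 * (natE c.apexD).length + 2 + (2 * (rawE bitE c.ge).length + 2 + (2 * (rawE bitE c.le).length + 2 +
    (2 * (optE natE c.cand).length + 2 + 0))))))))))) ≤ _
  omega

/-- The state size polynomial. [folklore] -/
def dataSize (P : UParams) (K t : ℕ) : ℕ :=
  2 * (P.D * 12) + 2 * (t * (2 * (4 * (P.D * (6 * K + 6)) + 4 * Nat.size P.amax + 2 * K + 34) + 2)) +
    2 * scrSize P K t + 18

/-- **The state code has polynomial length** under the size invariant. [cite: FournierKoiran2000, §2.2] -/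
theorem length_dataE_le {d : UData} (h : USz P K t d) : (dataE d).length ≤ dataSize P K t := by
  have h1 : (bitE d.done).length = 1 := rfl
  have h2 : (bitE d.out).length = 1 := rfl
  have h3 : (vecE d.chart).length ≤ P.D * 12 := by
    have := length_vecE_le (l := d.chart) (k := 1) fun a ha => by have := h.chart a ha; omega
    exact this.trans (Nat.mul_le_mul_right _ h.chartLen)
  have h4 : (rawE lrecE d.levels).length ≤ t * (2 * (4 * (P.D * (6 * K + 6)) + 4 * Nat.size P.amax + 2 * K + 34) + 2) :=
    (length_rawE_le_of_forall lrecE fun r hr => length_lrecE_le (h.levels r hr)).trans (Nat.mul_le_mul_right _ h.levelsLen)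
  have h5 := length_scrE_le h.cur
  simp only [dataE, dataFields, rawE_cons, rawE_nil, length_boolPair, List.length_nil]
  unfold dataSize
  change 2 * (bitE d.done).length + 2 + (2 * (bitE d.out).length + 2 + (2 * (vecE d.chart).length + 2 +
    (2 * (rawE lrecE d.levels).length + 2 + (2 * (scrE d.cur).length + 2 + 0)))) ≤ _
  omega

/-- `scrSize` is monotone. [folklore] -/
theorem scrSize_mono (P : UParams) {K K' t t' : ℕ} (hK : K ≤ K') (ht : t ≤ t') : scrSize P K t ≤ scrSize P K' t' := by
  unfold scrSize
  have a1 : P.D * (6 * K + 6) ≤ P.D * (6 * K' + 6) := Nat.mul_le_mul_left _ (by omega)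
  have a2 : t * (2 * (P.D * (6 * K + 6)) + 2) ≤ t' * (2 * (P.D * (6 * K' + 6)) + 2) := Nat.mul_le_mul ht (by omega)
  omega

/-- `dataSize` is monotone. [folklore] -/
theorem dataSize_mono (P : UParams) {K K' t t' : ℕ} (hK : K ≤ K') (ht : t ≤ t') : dataSize P K t ≤ dataSize P K' t' := by
  unfold dataSize
  have a1 : P.D * (6 * K + 6) ≤ P.D * (6 * K' + 6) := Nat.mul_le_mul_left _ (by omega)
  have a2 : t * (2 * (4 * (P.D * (6 * K + 6)) + 4 * Nat.size P.amax + 2 * K + 34) + 2) ≤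
      t' * (2 * (4 * (P.D * (6 * K' + 6)) + 4 * Nat.size P.amax + 2 * K' + 34) + 2) := Nat.mul_le_mul ht (by omega)
  have a3 := scrSize_mono P hK ht
  omega

end Length

/-! ### Arguments of the scheduled tasks -/

/-- Every task of a level has arguments at most `amax`. [folklore] -/
theorem argsLe_of_mem_ulevelTasks (P : UParams) (j : ℕ) {τ : UTask} (hτ : τ ∈ ulevelTasks P j) : τ.ArgsLe P.amax := by
  intro a ha
  unfold UParams.amax
  unfold ulevelTasks at hτ
  rcases List.mem_append.1 hτ with hτ | hτ
  · rcases List.mem_append.1 hτ with hτ | hτ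
    · rcases List.mem_append.1 hτ with hτ | hτ
      · rw [List.mem_ite_nil_left] at hτ
        obtain ⟨-, hτ⟩ := hτ
        rcases List.mem_append.1 hτ with hτ | hτ
        · rcases List.mem_append.1 hτ with hτ | hτ
          · obtain ⟨i, hi, hτ⟩ := List.mem_flatMap.1 hτ
            obtain ⟨k, hk, rfl⟩ := List.mem_map.1 hτ
            rw [List.mem_range] at hi hk
            simp only [UTask.args, List.mem_cons, List.not_mem_nil, or_false] at ha
            rcases ha with rfl | rfl <;> omega
          · obtain ⟨sc, hsc, hτ⟩ := List.mem_flatMap.1 hτ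
            rw [List.mem_range] at hsc
            rcases List.mem_append.1 hτ with hτ | hτ
            · obtain ⟨m, hm, hτ⟩ := List.mem_flatMap.1 hτ
              rw [List.mem_range] at hm
              rcases List.mem_cons.1 hτ with rfl | hτ
              · simp only [UTask.args, List.mem_cons, List.not_mem_nil, or_false] at ha
                rcases ha with rfl | rfl <;> omega
              · obtain ⟨w, hw, rfl⟩ := List.mem_map.1 hτ
                rw [List.mem_range] at hw
                simp only [UTask.args, List.mem_cons, List.not_mem_nil, or_false] at ha
                rcases ha with rfl | rfl | rfl <;> omega
            · rw [List.mem_singleton] at hτ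
              subst hτ
              simp only [UTask.args, List.mem_cons, List.not_mem_nil, or_false] at ha
              omega
        · obtain ⟨w, hw, rfl⟩ := List.mem_map.1 hτ
          rw [List.mem_range] at hw
          simp only [UTask.args, List.mem_cons, List.not_mem_nil, or_false] at ha
          omega
      · obtain ⟨i, hi, hτ⟩ := List.mem_flatMap.1 hτ
        rw [List.mem_range] at hi
        simp only [List.mem_cons, List.not_mem_nil, or_false] at hτ
        rcases hτ with rfl | rfl <;>
          · simp only [UTask.args, List.mem_cons, List.not_mem_nil, or_false] at ha; omega
    · obtain ⟨i, hi, rfl⟩ := List.mem_map.1 hτ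
      rw [List.mem_range] at hi
      simp only [UTask.args, List.mem_cons, List.not_mem_nil, or_false] at ha
      omega
  · rw [List.mem_singleton] at hτ
    subst hτ
    simp [UTask.args] at ha

/-- Every task of the schedule has arguments at most `amax`. [folklore] -/
theorem argsLe_of_mem_uagenda (P : UParams) {τ : UTask} (h : τ ∈ uagenda P) : τ.ArgsLe P.amax := by
  unfold uagenda at h
  obtain ⟨j, _, hj⟩ := List.mem_flatMap.1 h
  exact argsLe_of_mem_ulevelTasks P j hj

end FKPointLocation

end Literature.Computability.Complexity
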